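import Mathlib
import HarnessLib
import Summits.NavierStokesRegularity.NavierStokesRegularity.Theorems.PoloidalWindowDoorLrcModEntireSheetFlattenTools

/-!
# Route `PoloidalWindowDoor`, item `LrcModEntire` (stmt-NavierStokesRegularity-20428), cell (Q4) of the (TH) column —
# PARALLEL WEBS, I: THE HUYGENS IDENTITY `κ G_z² = (R″ − μκ)(1 + G_s²)` along a homogeneous web over a straight branch
# (brick P1 of LEAD memo T2B-g16 §2/§6(iii), class-free; first half)

Cell ns-regularity-ideate, LEAD-lineage seat ns-poloidal-K2-p3 g16 (`--supports stmt-NavierStokesRegularity-20428`).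

Setting (one slice): `F : ℝ³ → ℝ` of class `C³`, a horizontal unit vector `e` with `ν = Je`, and a `C²` WEB FUNCTION `G(s,z)` on
`ℝ × I` (`I` an open interval around `0`) describing the web points `W(s,z) = s·e + G(s,z)·ν + z·e₂` of the cross-sections based on
the line `Γ = ℝe`, with: the horizontal gradient of `F` vanishes on the web (`∂_νF(W) = ∂_eF(W) = 0`), the web values depend on
the height only (`F(W(s,z)) = R(z)`), the RIDGE LAW (`D²F(W)[e,e] + D²F(W)[ν,ν] = −κ(z) < 0`, height-only), the SLICE LAW at the web
(`D²F(W)[e₂,e₂] = −μ(z)(D²F(W)[e,e] + D²F(W)[ν,ν])`), and `G(s,0) = 0` (the base web is the line itself).  Then: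

* `huygens_identity` — **`κ(z)·(∂_zG)² = (R″(z) − μ(z)κ(z))·(1 + (∂_sG)²)`** on `ℝ × I` (implicit differentiation of the three web
  identities; memo §2 display): the normal speed of the web in `z` is the same for all `s`;
* `webFun_eq_of_huygens` — **`G(s,z) = G(0,z)`**: differentiating the identity in `s` gives `κ G_z ∂_zH = c H ∂_sH` for `H = ∂_sG`,
  whence `|∂_zH| ≤ A|H|` along every vertical line (where `G_z = 0` the height is a zero of `c` and `∂_zH = ∂_s G_z = 0`); Grönwall
  from `H(s,0) = 0` kills `H`;
* `parallelWebs` — the package used by the wiring of `stub_Q4line`: the webs are the lines `{s·e + d(z)·ν + z·e₂}` with `d = G(0,·)`,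
  and `κ·d′² = R″ − μκ` (so the sheet is non-characteristic at `z` iff `R″(z) ≠ 0`).

WHAT THIS IS NOT: not a claim about Navier–Stokes regularity; a calculus brick (bears_on LADDER-NS N0 via item 20428).
-/

noncomputable section

set_option linter.dupNamespace false
set_option linter.unusedVariables false

namespace Summit.NavierStokesRegularity.NavierStokesRegularity.Theorems.PoloidalWindowDoorLrcModEntireParallelWebsIdentity

open Set Function Filter Topology
open scoped ContDiff
open Summit.NavierStokesRegularity.NavierStokesRegularity.Theorems.PoloidalWindowDoorLrcModEntireSheetFlattenTools

/-! ### Part A — the pointwise algebra -/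

/-- **The Huygens relation from the six web identities** (pure algebra).  With `b = B(ν,ν)`:
`B(e,ν) = −G_s b`, `B(e₂,ν) = −G_z b`, `B(e,e) = −G_s B(e,ν)`, `B(e,e) + b = −κ`, `G_z B(e₂,ν) + B(e₂,e₂) = R″`,
`B(e₂,e₂) = −μ (B(e,e) + b)` ⇒ `κ G_z² = (R″ − μκ)(1 + G_s²)`. -/
theorem huygens_algebra {b Ben Be2n Bee Be2e2 Gs Gz κ μ R2 : ℝ}
    (h1 : Ben = -Gs * b) (h2 : Be2n = -Gz * b) (h3 : Bee = -Gs * Ben) (h4 : Bee + b = -κ)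
    (h5 : Gz * Be2n + Be2e2 = R2) (h6 : Be2e2 = -μ * (Bee + b)) :
    κ * Gz ^ 2 = (R2 - μ * κ) * (1 + Gs ^ 2) := by
  have hb : b * (1 + Gs ^ 2) = -κ := by rw [h3, h1] at h4; linear_combination h4
  have h7 : Be2e2 = R2 + Gz ^ 2 * b := by rw [h2] at h5; linear_combination h5
  have h8 : Gz ^ 2 * b = μ * κ - R2 := by rw [h4] at h6; linear_combination h6 - h7
  linear_combination Gz ^ 2 * hb - (1 + Gs ^ 2) * h8

/-! ### Part B — calculus along the web `W(p) = p.1·e + G(p)·ν + p.2·e₂` -/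

/-- The web map of a web function `G : ℝ × ℝ → ℝ` over the line `ℝe`. -/
def webMap (e : EuclideanSpace ℝ (Fin 3)) (G : ℝ × ℝ → ℝ) (p : ℝ × ℝ) : EuclideanSpace ℝ (Fin 3) :=
  p.1 • e + G p • Jvec e + p.2 • e2

/-- The parameter region `ℝ × I`. -/
def region (I : Set ℝ) : Set (ℝ × ℝ) := {p | p.2 ∈ I}

/-- The region over an open set of heights is open. -/
theorem isOpen_region {I : Set ℝ} (hI : IsOpen I) : IsOpen (region I) := hI.preimage continuous_snd

/-- Derivative of the web map: `DW(p)[h] = h.1·e + DG(p)[h]·ν + h.2·e₂`. -/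
theorem hasFDerivAt_webMap (e : EuclideanSpace ℝ (Fin 3)) {G : ℝ × ℝ → ℝ} {p : ℝ × ℝ} (hG : DifferentiableAt ℝ G p) :
    HasFDerivAt (webMap e G)
      ((ContinuousLinearMap.fst ℝ ℝ ℝ).smulRight e + (fderiv ℝ G p).smulRight (Jvec e) +
        (ContinuousLinearMap.snd ℝ ℝ ℝ).smulRight e2) p := by
  have h1 : HasFDerivAt (fun q : ℝ × ℝ => q.1 • e) ((ContinuousLinearMap.fst ℝ ℝ ℝ).smulRight e) p :=
    (ContinuousLinearMap.fst ℝ ℝ ℝ).hasFDerivAt.smul_const e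
  have h2 : HasFDerivAt (fun q : ℝ × ℝ => G q • Jvec e) ((fderiv ℝ G p).smulRight (Jvec e)) p :=
    hG.hasFDerivAt.smul_const (Jvec e)
  have h3 : HasFDerivAt (fun q : ℝ × ℝ => q.2 • e2) ((ContinuousLinearMap.snd ℝ ℝ ℝ).smulRight e2) p :=
    (ContinuousLinearMap.snd ℝ ℝ ℝ).hasFDerivAt.smul_const e2
  exact (h1.add h2).add h3

/-- The derivative of the web map on the two coordinate directions. -/
theorem fderiv_webMap_apply (e : EuclideanSpace ℝ (Fin 3)) {G : ℝ × ℝ → ℝ} {p : ℝ × ℝ} (hG : DifferentiableAt ℝ G p)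
    (h : ℝ × ℝ) : fderiv ℝ (webMap e G) p h = h.1 • e + fderiv ℝ G p h • Jvec e + h.2 • e2 := by
  rw [(hasFDerivAt_webMap e hG).fderiv]
  simp

/-- Chain rule: the derivative of `p ↦ g(W(p))` for a differentiable scalar `g`. -/
theorem fderiv_comp_webMap (e : EuclideanSpace ℝ (Fin 3)) {G : ℝ × ℝ → ℝ} {p : ℝ × ℝ} (hG : DifferentiableAt ℝ G p)
    {g : EuclideanSpace ℝ (Fin 3) → ℝ} (hg : DifferentiableAt ℝ g (webMap e G p)) (h : ℝ × ℝ) :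
    fderiv ℝ (fun q => g (webMap e G q)) p h =
      fderiv ℝ g (webMap e G p) (h.1 • e + fderiv ℝ G p h • Jvec e + h.2 • e2) := by
  have hc := hg.hasFDerivAt.comp p (hasFDerivAt_webMap e hG)
  rw [show (fun q => g (webMap e G q)) = g ∘ webMap e G from rfl, hc.fderiv]
  simp

/-- A function vanishing on the open region has vanishing derivative there. -/
theorem fderiv_eq_zero_of_eqOn_region {I : Set ℝ} (hI : IsOpen I) {φ : ℝ × ℝ → ℝ} (hφ : ∀ p ∈ region I, φ p = 0)
    {p : ℝ × ℝ} (hp : p ∈ region I) (h : ℝ × ℝ) : fderiv ℝ φ p h = 0 := by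
  have hev : φ =ᶠ[𝓝 p] fun _ => 0 :=
    Filter.eventuallyEq_of_mem ((isOpen_region hI).mem_nhds hp) fun q hq => hφ q hq
  rw [hev.fderiv_eq]; simp

/-- **The six web identities ⇒ the Huygens relation, at one point of the web.**  For `F ∈ C³`, a `C¹` web function `G` on the
open region `ℝ × I` with `∂_νF(W) = ∂_eF(W) = 0`, `F(W(s,z)) = R(z)` (`R ∈ C²` on `I`), the ridge law `B(e,e) + B(ν,ν) = −κ(z)` and
the slice law `B(e₂,e₂) = −μ(z)(B(e,e) + B(ν,ν))` for `B = D²F(W(s,z))`: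
`κ(z)·(D G(p)[(0,1)])² = (R″(z) − μ(z)κ(z))·(1 + (DG(p)[(1,0)])²)`. -/
theorem huygens_identity {F : EuclideanSpace ℝ (Fin 3) → ℝ} (hF : ContDiff ℝ 3 F) (e : EuclideanSpace ℝ (Fin 3))
    {I : Set ℝ} (hI : IsOpen I) {G : ℝ × ℝ → ℝ} (hG : ∀ p ∈ region I, DifferentiableAt ℝ G p)
    {R κ μ : ℝ → ℝ} (hR : ∀ z ∈ I, HasDerivAt (deriv R) (deriv (deriv R) z) z)
    (hR1 : ∀ z ∈ I, DifferentiableAt ℝ R z)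
    (hν : ∀ p ∈ region I, fderiv ℝ F (webMap e G p) (Jvec e) = 0)
    (he : ∀ p ∈ region I, fderiv ℝ F (webMap e G p) e = 0)
    (hval : ∀ p ∈ region I, F (webMap e G p) = R p.2)
    (hridge : ∀ p ∈ region I, fderiv ℝ (fderiv ℝ F) (webMap e G p) e e + fderiv ℝ (fderiv ℝ F) (webMap e G p) (Jvec e) (Jvec e) = -κ p.2)
    (hslice : ∀ p ∈ region I, fderiv ℝ (fderiv ℝ F) (webMap e G p) e2 e2 =
      -μ p.2 * (fderiv ℝ (fderiv ℝ F) (webMap e G p) e e + fderiv ℝ (fderiv ℝ F) (webMap e G p) (Jvec e) (Jvec e)))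
    {p : ℝ × ℝ} (hp : p ∈ region I) :
    κ p.2 * (fderiv ℝ G p (0, 1)) ^ 2 = (deriv (deriv R) p.2 - μ p.2 * κ p.2) * (1 + (fderiv ℝ G p (1, 0)) ^ 2) := by
  set W := webMap e G with hW
  set x := W p with hx
  set B := fderiv ℝ (fderiv ℝ F) x with hB
  set ν := Jvec e with hνdef
  have hF1 : Differentiable ℝ F := hF.differentiable (by norm_num)
  have hF2 : ContDiff ℝ 2 F := hF.of_le (by norm_num)
  have hDF : ∀ y, DifferentiableAt ℝ (fderiv ℝ F) y := fun y =>
    ((hF.fderiv_right (m := 2) (by norm_num)).differentiable (by norm_num)) y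
  have hsymm : ∀ a c : EuclideanSpace ℝ (Fin 3), B a c = B c a := fun a c =>
    (hF2.contDiffAt.isSymmSndFDerivAt (by simp)) a c
  have hGp := hG p hp
  -- derivative of `q ↦ DF(W q)[w]` in direction `h`: `B (DW h) w`
  have hD : ∀ (w : EuclideanSpace ℝ (Fin 3)) (h : ℝ × ℝ),
      fderiv ℝ (fun q => fderiv ℝ F (W q) w) p h = B (h.1 • e + fderiv ℝ G p h • ν + h.2 • e2) w := by
    intro w h
    have hg : DifferentiableAt ℝ (fun y => fderiv ℝ F y w) (W p) := (hDF _).clm_apply (differentiableAt_const w)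
    rw [fderiv_comp_webMap e hGp hg h]
    rw [fderiv_clm_apply (hDF _) (differentiableAt_const w)]
    simp [hB, hx, hνdef, hW]
  -- (I1) `∂_νF(W) ≡ 0` differentiated in `s` and in `z`
  have I1s : B e ν + fderiv ℝ G p (1, 0) * B ν ν = 0 := by
    have h := fderiv_eq_zero_of_eqOn_region hI hν hp (1, 0)
    rw [hD] at h
    simpa [map_add, map_smul, _root_.add_apply, _root_.smul_apply, smul_eq_mul] using h
  have I1z : fderiv ℝ G p (0, 1) * B ν ν + B e2 ν = 0 := by
    have h := fderiv_eq_zero_of_eqOn_region hI hν hp (0, 1)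
    rw [hD] at h
    simpa [map_add, map_smul, _root_.add_apply, _root_.smul_apply, smul_eq_mul] using h
  -- (I2) `∂_eF(W) ≡ 0` differentiated in `s`
  have I2s : B e e + fderiv ℝ G p (1, 0) * B ν e = 0 := by
    have h := fderiv_eq_zero_of_eqOn_region hI he hp (1, 0)
    rw [hD] at h
    simpa [map_add, map_smul, _root_.add_apply, _root_.smul_apply, smul_eq_mul] using h
  -- (I3) `F(W) = R(z)` differentiated in `z`: `∂_{e₂}F(W) = R′(z)` on the region, then once more
  have I3a : ∀ q ∈ region I, fderiv ℝ F (W q) e2 = deriv R q.2 := by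
    intro q hq
    have hGq := hG q hq
    have hd : fderiv ℝ (fun q' => F (W q')) q (0, 1) = fderiv ℝ (fun q' : ℝ × ℝ => R q'.2) q (0, 1) := by
      have hev : (fun q' => F (W q')) =ᶠ[𝓝 q] fun q' : ℝ × ℝ => R q'.2 :=
        Filter.eventuallyEq_of_mem ((isOpen_region hI).mem_nhds hq) fun q' hq' => hval q' hq'
      rw [hev.fderiv_eq]
    rw [fderiv_comp_webMap e hGq (hF1 _) (0, 1)] at hd
    have hRd : fderiv ℝ (fun q' : ℝ × ℝ => R q'.2) q (0, 1) = deriv R q.2 := by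
      have hc : HasFDerivAt (fun q' : ℝ × ℝ => R q'.2)
          ((fderiv ℝ R q.2).comp (ContinuousLinearMap.snd ℝ ℝ ℝ)) q :=
        HasFDerivAt.comp q (hR1 q.2 hq).hasFDerivAt hasFDerivAt_snd
      rw [hc.fderiv]
      simp
    rw [hRd] at hd
    have hlin : fderiv ℝ F (W q) ((0 : ℝ) • e + fderiv ℝ G q (0, 1) • Jvec e + (1 : ℝ) • e2) =
        fderiv ℝ G q (0, 1) * fderiv ℝ F (W q) (Jvec e) + fderiv ℝ F (W q) e2 := by
      simp [map_add, map_smul, smul_eq_mul]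
    rw [hlin, hν q hq, mul_zero, zero_add] at hd
    simpa using hd
  have I3 : fderiv ℝ G p (0, 1) * B e2 ν + B e2 e2 = deriv (deriv R) p.2 := by
    -- differentiate `q ↦ ∂_{e₂}F(W q) − R′(q.2)` (≡ 0 on the region) in the direction `(0,1)`
    have hφ : ∀ q ∈ region I, (fun q => fderiv ℝ F (W q) e2 - deriv R q.2) q = 0 := fun q hq => by
      simp [I3a q hq]
    have h := fderiv_eq_zero_of_eqOn_region hI hφ hp (0, 1)
    have hd1 : DifferentiableAt ℝ (fun q => fderiv ℝ F (W q) e2) p :=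
      ((hDF _).clm_apply (differentiableAt_const e2)).comp p (hasFDerivAt_webMap e hGp).differentiableAt
    have hd2 : DifferentiableAt ℝ (fun q : ℝ × ℝ => deriv R q.2) p := (hR p.2 hp).differentiableAt.comp p differentiableAt_snd
    rw [fderiv_fun_sub hd1 hd2] at h
    have hRd : fderiv ℝ (fun q : ℝ × ℝ => deriv R q.2) p (0, 1) = deriv (deriv R) p.2 := by
      have hc : HasFDerivAt (fun q' : ℝ × ℝ => deriv R q'.2)
          ((ContinuousLinearMap.smulRight (1 : ℝ →L[ℝ] ℝ) (deriv (deriv R) p.2)).comp (ContinuousLinearMap.snd ℝ ℝ ℝ)) p :=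
        (hR p.2 hp).hasFDerivAt.comp p hasFDerivAt_snd
      rw [hc.fderiv]
      simp
    simp only [_root_.sub_apply, hD, hRd] at h
    have : B ((0 : ℝ) • e + fderiv ℝ G p (0, 1) • ν + (1 : ℝ) • e2) e2 = fderiv ℝ G p (0, 1) * B ν e2 + B e2 e2 := by
      simp [map_add, map_smul, _root_.add_apply, _root_.smul_apply, smul_eq_mul]
    rw [this, hsymm ν e2] at h
    linarith
  -- assemble
  have hr := hridge p hp
  have hsl := hslice p hp
  exact huygens_algebra (b := B ν ν) (Ben := B e ν) (Be2n := B e2 ν) (Bee := B e e) (Be2e2 := B e2 e2)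
    (Gs := fderiv ℝ G p (1, 0)) (Gz := fderiv ℝ G p (0, 1)) (κ := κ p.2) (μ := μ p.2) (R2 := deriv (deriv R) p.2)
    (by linear_combination I1s) (by linear_combination I1z) (by rw [hsymm ν e] at I2s; linear_combination I2s)
    hr I3 hsl


end Summit.NavierStokesRegularity.NavierStokesRegularity.Theorems.PoloidalWindowDoorLrcModEntireParallelWebsIdentity
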